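import Summits.Ventures.CertifiedManyBodySolver.Downfold.EmeryBoxesPr438outYK26ThermalCapRetiltMarkovBoxp1
import Summits.Ventures.CertifiedManyBodySolver.Downfold.EmeryBoxesPr438outYK26ThermalFloorAtlasWord
import Summits.Ventures.CertifiedManyBodySolver.Downfold.EmeryThermalAtomicFloor
import HarnessLib

/-!
# HIGH-TEMPERATURE-CLOSING `T > 0` WINDOW on Pr₄Ni₃O₈ (#189 = VSET-v8 M330; T′ TRILAYER nickelate, La-proxy for Pr = INFL-4f member; se — `emeryBoxPr438outYK26` (router/EMERY-FLOOR-ORDERS row 65): the ATOMIC-LIMIT floor (full entropy) ∨ the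
# family floor, against the re-tilted cap — both sides meet at `6 log 2` as β → 0

Venture CertifiedManyBodySolver, cell `pub/hubbard-downfold` (S1 = ROUTER) × crew hubbard-fast S2 (ii) × (iv) «T > 0 × multi-band» (D-0096 (ii)); seat hubbard-downfold-mod-4
(S1/S2 Emery seam, g17). Namespace `Summit.Ventures.CertifiedManyBodySolver.Downfold`. DOOR: `EmeryThermalAtomicFloor` (`holdsOn_emeryCellPressureAtomicFloor`: Peierls on the
whole occupation basis of the `Cu₄O₈` block, site-wise factorisation; the one-site function is the tree's `atomicPartitionFnReal β U μ`). INPUTS BY NAME: the family floor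
`emeryBoxPr438outYK26_pressureFloorFam_m48o5` (`EmeryBoxesPr438outYK26ThermalFloorAtlasWord`; C = (-139.505965, -140.887478)), the cap `emeryBoxPr438outYK26_pressureCap_m48o5_retilt` (`EmeryBoxesPr438outYK26ThermalCapRetiltMarkovBoxp1`; `6 log 2 + 39.4334·β`; flat word 42.6334).
ATOMIC DATA: Cu at `μ_d = −(εp + Δ_hi) = 433/100`, `U_d,hi = 4599/1000`; O at `μ_p = −εp = 48/5`, `U_p,hi = 4127/1000` ⇒ classical slope 34.4760·β (family slope 35.2219; cap 39.4334).
RESULT: **`emeryBoxPr438outYK26_pressureWindowHighT_m48o5`**: `max(atomic, family) ≤ P_cell ≤ 6 log 2 + 39.4334·β` on the whole box, every β ≥ 0; width → 0 as β → 0 (both sides `6 log 2`,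
`emeryBoxPr438outYK26_pressure_beta_zero_m48o5`); crossover β* ≈ 1.289 (T* ≈ 9000 K) below which the atomic floor is the better floor [float].

Everything PROVED (0 sorry); no definition. HONEST FRAMING: CERTIFIED inequalities on a SCREENING/EXTRAPOLATED-grade object; the atomic floor ignores hopping (its slope sits
0.7459 below the family floor's), so at physical temperatures (β ≈ 20–40 eV⁻¹) the family floor still decides and thermal scales are NOT resolved there; what is new
is the correct INFINITE-TEMPERATURE closure of the window and a certified high-T regime (β ≲ β*) with width `≈ 4.9574·β`; grand-canonical at the stated level; no phase word;
no router number moves. WHAT-THIS-IS-NOT: a new certificate (pure algebra on landed objects; zero kit).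
-/

noncomputable section

namespace Summit.Ventures.CertifiedManyBodySolver.Downfold

open NonemptyInterval Matrix Finset Literature.Probability.LatticeModels
open Literature.MathematicalPhysics.QuantumLattice Literature.Computation.Certificates
open Summit.Ventures.CertifiedManyBodySolver.Certificates OccupationCode ClusterLowerBound
open scoped BigOperators ComplexOrder

/-! ## §1 The atomic-limit floor on the box at εp = -48/5 -/

/-- **ATOMIC-LIMIT `T > 0` FLOOR** on the whole `emeryBoxPr438outYK26`, cuprate signs, level εp = -48/5 (chemical potential 48/5 eV), EVERY β ≥ 0:
`log z₀(β; U_d = 4599/1000, μ_d = 433/100) + 2·log z₀(β; U_p = 4127/1000, μ_p = 48/5) ≤ P_cell` with `z₀(β; U, μ) = 1 + 2e^{βμ} + e^{−β(U−2μ)}` (`atomicPartitionFnReal`; Cu at the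
box's upper level `εp + Δ_hi = -433/100` and `U_d,hi`, O at `εp` and `U_p,hi`). Value `6 log 2` at β = 0; slope `34.4760·β` as β → ∞ (classical minimum, no hopping).
[cite: Ruelle1969, §2.5–2.6] [cite: Ueltschi1999, §3] -/
theorem emeryBoxPr438outYK26_pressureAtomicFloor_m48o5 {β : ℝ} (hβ : 0 ≤ β) :
    HoldsOn (fun p : EmeryCoord → ℝ => Real.log (atomicPartitionFnReal β (4599/1000 : ℝ) (433/100 : ℝ)) + 2 * Real.log (atomicPartitionFnReal β (4127/1000 : ℝ) (48/5 : ℝ)) ≤ emeryCellPressure β (emeryLine cuprateSigns (emeryLineCoords (((-48/5 : ℚ)) : ℝ) p))) emeryBoxPr438outYK26 := by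
  intro p hp
  have h := holdsOn_emeryCellPressureAtomicFloor (E := emeryBoxPr438outYK26) (eA := pr438outYK26Emery_tpd) (eB := pr438outYK26Emery_tpp) (eD := pr438outYK26Emery_Delta) (eUd := pr438outYK26Emery_Udd) (eUp := pr438outYK26Emery_Upp) (-48/5) (by simp [emeryBoxPr438outYK26, emeryBoxPr438outYK26Src, Function.update]) (by simp [emeryBoxPr438outYK26, emeryBoxPr438outYK26Src, Function.update]) (Function.update_self _ _ _) (by simp [emeryBoxPr438outYK26, emeryBoxPr438outYK26Src, Function.update]) (by simp [emeryBoxPr438outYK26, emeryBoxPr438outYK26Src, Function.update]) cuprateSigns hβ p hp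
  simp only [pr438outYK26Emery_Delta, pr438outYK26Emery_Udd, pr438outYK26Emery_Upp, Entry.encl_ofEnds_snd] at h
  push_cast at h
  norm_num at h ⊢
  exact h

/-! ## §2 The best floor and the HIGH-TEMPERATURE-CLOSING window -/

/-- **BEST `T > 0` FLOOR = max(atomic, family)** on the whole box at εp = -48/5, every β ≥ 0: the atomic floor (full entropy, slope 34.4760) wins for
β < β* ≈ 1.289 (T > 9000 K), the family floor `emeryBoxPr438outYK26_pressureFloorFam_m48o5` (slope 35.2219, entropy ¼·log 2) for β > β*. [cite: Ruelle1969, §2.5–2.6] [cite: Israel1979, Lemma II.3.1] -/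
theorem emeryBoxPr438outYK26_pressureFloorBest_m48o5 {β : ℝ} (hβ : 0 ≤ β) :
    HoldsOn (fun p : EmeryCoord → ℝ => max (Real.log (atomicPartitionFnReal β (4599/1000 : ℝ) (433/100 : ℝ)) + 2 * Real.log (atomicPartitionFnReal β (4127/1000 : ℝ) (48/5 : ℝ))) (Real.log (Real.exp (-(β * (-27901193/200000 : ℝ))) + Real.exp (-(β * (-70443739/500000 : ℝ)))) / 4) ≤ emeryCellPressure β (emeryLine cuprateSigns (emeryLineCoords (((-48/5 : ℚ)) : ℝ) p))) emeryBoxPr438outYK26 :=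
  fun p hp => max_le (emeryBoxPr438outYK26_pressureAtomicFloor_m48o5 hβ p hp) (emeryBoxPr438outYK26_pressureFloorFam_m48o5 hβ p hp)

/-- **THE HIGH-TEMPERATURE-CLOSING TWO-SIDED `T > 0` WINDOW** (hypothesis-free on both sides) on the whole `emeryBoxPr438outYK26`, level εp = -48/5, EVERY β ≥ 0:
`max(atomic, family) ≤ P_cell ≤ 6 log 2 + β·6309343/160000` (cap = `emeryBoxPr438outYK26_pressureCap_m48o5_retilt`, hubbard-box-p1 re-tilted). BOTH SIDES EQUAL `6 log 2` AT β = 0; the width is `O(β)` for small β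
(slope gap 4.9574 against the atomic floor, 4.2115 against the family floor). Table [float; `T = 11604.5/β` K]:
| β (1/eV) | T (K) | atomic floor | family floor | best floor | cap | width |
|---|---|---|---|---|---|---|
| 0.01 | 1160450 | 4.3651 | 0.5238 | 4.3651 | 4.5532 | 0.1881 |
| 0.1 | 116045 | 6.4676 | 3.6788 | 6.4676 | 8.1022 | 1.6346 |
| 0.5 | 23209 | 18.5776 | 17.7125 | 18.5776 | 23.8756 | 5.2980 |
| 1 | 11604 | 35.5142 | 35.2779 | 35.5142 | 43.5923 | 8.0781 |
| 2 | 5802 | 69.9014 | 70.4590 | 70.4590 | 83.0257 | 12.5666 |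
| 5 | 2321 | 173.1956 | 176.1096 | 176.1096 | 201.3259 | 25.2163 |
| 10 | 1160 | 345.4865 | 352.2187 | 352.2187 | 398.4928 | 46.2741 |
| 20 | 580 | 690.2154 | 704.4374 | 704.4374 | 792.8268 | 88.3894 |
| 40 | 290 | 1379.7332 | 1408.8748 | 1408.8748 | 1581.4946 | 172.6199 |
[cite: Israel1979, Thm. I.2.4] [cite: Ruelle1969, §2.5–2.6] [cite: Ueltschi1999, §3] -/
theorem emeryBoxPr438outYK26_pressureWindowHighT_m48o5 {β : ℝ} (hβ : 0 ≤ β) :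
    HoldsOn (fun p : EmeryCoord → ℝ =>
      max (Real.log (atomicPartitionFnReal β (4599/1000 : ℝ) (433/100 : ℝ)) + 2 * Real.log (atomicPartitionFnReal β (4127/1000 : ℝ) (48/5 : ℝ))) (Real.log (Real.exp (-(β * (-27901193/200000 : ℝ))) + Real.exp (-(β * (-70443739/500000 : ℝ)))) / 4) ≤ emeryCellPressure β (emeryLine cuprateSigns (emeryLineCoords (((-48/5 : ℚ)) : ℝ) p)) ∧
      emeryCellPressure β (emeryLine cuprateSigns (emeryLineCoords (((-48/5 : ℚ)) : ℝ) p)) ≤ 6 * Real.log 2 + β * (6309343/160000 : ℝ)) emeryBoxPr438outYK26 :=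
  fun p hp => ⟨emeryBoxPr438outYK26_pressureFloorBest_m48o5 hβ p hp, by simpa using emeryBoxPr438outYK26_pressureCap_m48o5_retilt hβ p hp⟩

/-- **At β = 0 the window is a point**: `P_cell(0, ·) = 6 log 2` on the whole box (floor and cap coincide). [cite: Ueltschi1999, §3] -/
theorem emeryBoxPr438outYK26_pressure_beta_zero_m48o5 :
    HoldsOn (fun p : EmeryCoord → ℝ => emeryCellPressure 0 (emeryLine cuprateSigns (emeryLineCoords (((-48/5 : ℚ)) : ℝ) p)) = 6 * Real.log 2) emeryBoxPr438outYK26 := by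
  intro p hp
  have h := emeryBoxPr438outYK26_pressureWindowHighT_m48o5 le_rfl p hp
  rw [atomicPartitionFnReal_beta_zero, atomicPartitionFnReal_beta_zero, show (4 : ℝ) = 2 ^ 2 by norm_num, Real.log_pow] at h
  simp only [Nat.cast_ofNat, zero_mul, add_zero] at h
  have h1 := (le_max_left _ _).trans h.1
  linarith [h.2]

end Summit.Ventures.CertifiedManyBodySolver.Downfold

end
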